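import Mathlib
import Summits.ValiantsHypothesis.ValiantsHypothesis.Theorems.NewtonUnitEquationsTwoProductsFormalLogLinearisationStubLogLinearisation
import Summits.ValiantsHypothesis.ValiantsHypothesis.Theorems.TwoProducts.Negative.PlanarSlotBoundFalseFamily
import HarnessLib

/-!
# Crux `TwoProducts` (stmt-ValiantsHypothesis-5906), line `planar_cell`: SUB₂ `PlanarSlotBound` is FALSE

Negative lane (val-lit-p3 g13, 2026-08-28; desk RULINGS #131/#133; evidence n°46 on stmt-5906).  With the staircase
family of `PlanarSlotBoundFalseFamily.lean` (`m = 2`):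

* the tail support is a CHAIN for the componentwise order (`pts_chain`), so every valid weight in the open negative
  quadrant induces the same order `R` on it — the whole quadrant is ONE cell;
* the `K+1` corners `q_k = p_{k,K-k}` are strict `ξ_k`-tops of `supp W`, `ξ_k = (-2, -(2k+1))` (`isStrictTop_corner`),
  hence strict tops of the log-support by the landed `stub_logLinearisation` (p584485) (`isStrictTop_corner_log`);
* `q_k` has the cross representative `δ_{f_k} + δ_{g_{K-k}}` (`∏ (μ+1) = 4 = (2·2)^1`, slot exponent `1` at `f_k`), the
  `q_k` are pairwise distinct, so the stub's set `D` may be taken `= {f_0, …, f_K}`: `#D = K+1`.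

Hence `not_planarSlotBound : ¬ (PlanarSlotBound unfolded verbatim)` — take `c = 1` and `K = 4^{c'}`.  The statement
refuted is the line's `def PlanarSlotBound` (l.484) with `lam E μ = Σ_i μ_i • E_i` and `tailSupport` unfolded, exactly
as `PlanarCellBound` is inlined in `…FormalLogLinearisationPlanarCellTransfer.lean` (p596451); a verbatim-copy defeq
check `example : ¬ PlanarSlotBound := not_planarSlotBound` elaborates (seat folder, work/lean/DefeqCheck.lean).

CONSEQUENCE FOR THE LINE: no `t`-free per-cell bound exists — here `t - 1 = #supp v₀ = (K+1)(K+4)/2` while the cell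
holds `K + 1 ≈ √(2t)` visible points — so `planarCellBound_of`'s `t`-free cell bound `2^{9c(1+c+c')m}(t+2)^0` is
unattainable and SUB₂ must be re-typed with a `poly(t)` budget (with which the line's `planarCount_cell` yields only a
quasi-polynomial `t^{O(log m)}`).  CLASSIFICATION: substantive for the stub as typed (the `t`-free claim is the
load-bearing content of SUB₂; the cheap repair `(2m)^{c'}(t+2)^{c''}` does not compose to the crux through
`planarCount_cell`).  Mechanism: GHOST PAIRS — each cancelled sum `f_i + g_j` (`i+j<K`) is itself a tail monomial of
`v₀`, so its planar fibre contains a depth-1 and a depth-2 lifted point with cancelling log-weights.  Honest framing: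
SUB₁ `PlanarCross`, `PlanarCellBound`, the engine, the crux `TwoProducts` and `VP ≠ VNP` are untouched (OPEN / NOT
proved). No named facts. [folklore]
-/

noncomputable section

-- Sub = Summit single-conjunct layout: the duplicated namespace component is mandated by the tree.
set_option linter.dupNamespace false

open scoped BigOperators
open MvPolynomial
open Summit.ValiantsHypothesis.ValiantsHypothesis.Theorems.NewtonUnitEquations.TwoProducts.FormalLogLinearisation

namespace Summit.ValiantsHypothesis.ValiantsHypothesis.Theorems.TwoProducts.Negative

namespace PlanarSlotBoundFalse
/-! ### The witness weights and the weights of grid points -/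

/-- The witness weight for corner `k`: `ξ_k = (-2, -(2k+1))` (both coordinates negative). [folklore] -/
def xi (k : ℕ) : Fin 2 → ℝ := ![-2, -(2 * (k : ℝ) + 1)]

/-- First coordinate of `ξ_k`. [folklore] -/
@[simp] theorem xi_zero (k : ℕ) : xi k 0 = -2 := rfl
/-- Second coordinate of `ξ_k`. [folklore] -/
@[simp] theorem xi_one (k : ℕ) : xi k 1 = -(2 * (k : ℝ) + 1) := rfl

/-- The weight of an exponent for `ξ_k`. [folklore] -/
theorem wt_xi (k : ℕ) (e : Expo) : wt (xi k) e = -(2 * (e 0 : ℝ) + (2 * k + 1) * (e 1 : ℝ)) := by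
  simp only [wt, xi_zero, xi_one]
  ring

/-- The weight of the grid point `p_{ij}` for `ξ_k` is minus its cost. [folklore] -/
theorem wt_xi_ppt (K k : ℕ) (ij : ℕ × ℕ) : wt (xi k) (ppt K ij) = -((cost K k ij.1 ij.2 : ℕ) : ℝ) := by
  rw [wt_xi, ppt_zero, ppt_one]
  simp only [cost]
  push_cast
  ring

/-! ### The possible tail exponents form a chain -/

/-- All exponents that can occur in the tails. [folklore] -/
def pts (K : ℕ) : Finset Expo :=
  ((idx K).image (fpt K) ∪ (idx K).image (gpt K)) ∪ (low K).image (ppt K)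

/-- The supports of the tails `u` lie in `pts`. [folklore] -/
theorem support_uu_subset (K : ℕ) (j : Fin 2) : (uu K j).support ⊆ pts K := by
  fin_cases j
  · simp only [uu, Fin.zero_eta, Matrix.cons_val_zero, support_u0, pts]
    exact Finset.subset_union_left.trans Finset.subset_union_left
  · simp only [uu, Fin.mk_one, Matrix.cons_val_one, Matrix.cons_val_zero, support_u1, pts]
    exact Finset.subset_union_right.trans Finset.subset_union_left

/-- The supports of the tails `v` lie in `pts`. [folklore] -/
theorem support_vv_subset (K : ℕ) (j : Fin 2) : (vv K j).support ⊆ pts K := by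
  classical
  fin_cases j
  · simp only [vv, Fin.zero_eta, Matrix.cons_val_zero]
    refine (support_add).trans (Finset.union_subset ((support_add).trans (Finset.union_subset ?_ ?_)) ?_)
    · rw [support_u0]; exact Finset.subset_union_left.trans Finset.subset_union_left
    · rw [support_u1]; exact Finset.subset_union_right.trans Finset.subset_union_left
    · rw [support_h]; exact Finset.subset_union_right
  · simp [vv]

/-- Coordinates of the possible exponents: `1 ≤ e₀`, and `e₀ ≤ b (e₁ + 1)`, `b e₁ ≤ e₀` off the axis. [folklore] -/
theorem pts_bounds (K : ℕ) {e : Expo} (he : e ∈ pts K) :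
    1 ≤ e 0 ∧ e 0 ≤ b K (e 1 + 1) ∧ (1 ≤ e 1 → b K (e 1) ≤ e 0) := by
  simp only [pts, Finset.mem_union, Finset.mem_image] at he
  rcases he with (⟨i, hi, rfl⟩ | ⟨j, hj, rfl⟩) | ⟨ij, hij, rfl⟩
  · rw [mem_idx] at hi
    refine ⟨by simpa using one_le_a K i, ?_, ?_⟩
    · simp only [fpt_zero, fpt_one]
      exact (a_lt_b K i 1 hi).le
    · simp
  · refine ⟨by simpa using one_le_b K j, ?_, ?_⟩
    · simp only [gpt_zero, gpt_one]; exact b_le_succ K j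
    · simp
  · rw [mem_low] at hij
    obtain ⟨hi, hj, hlt⟩ := hij
    refine ⟨?_, ?_, ?_⟩
    · simp only [ppt_zero]; have := one_le_b K ij.2; omega
    · simp only [ppt_zero, ppt_one, b_succ]
      have : a K ij.1 ≤ a K (K - (ij.2 + 1)) := a_le_a (by omega)
      omega
    · simp

/-- The possible exponents form a CHAIN for the componentwise order. [folklore] -/
theorem pts_chain (K : ℕ) {e e' : Expo} (he : e ∈ pts K) (he' : e' ∈ pts K) :
    (e 0 ≤ e' 0 ∧ e 1 ≤ e' 1) ∨ (e' 0 ≤ e 0 ∧ e' 1 ≤ e 1) := by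
  obtain ⟨_, hub, hlb⟩ := pts_bounds K he
  obtain ⟨_, hub', hlb'⟩ := pts_bounds K he'
  rcases lt_trichotomy (e 1) (e' 1) with h | h | h
  · left
    refine ⟨?_, h.le⟩
    calc e 0 ≤ b K (e 1 + 1) := hub
      _ ≤ b K (e' 1) := b_mono K (by omega)
      _ ≤ e' 0 := hlb' (by omega)
  · rcases le_total (e 0) (e' 0) with h0 | h0
    · exact Or.inl ⟨h0, h.le⟩
    · exact Or.inr ⟨h0, h.ge⟩
  · right
    refine ⟨?_, h.le⟩
    calc e' 0 ≤ b K (e' 1 + 1) := hub'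
      _ ≤ b K (e 1) := b_mono K (by omega)
      _ ≤ e 0 := hlb (by omega)

/-- On a chain, for a weight with both coordinates negative, `e' ≤ e` componentwise iff `wt ξ e ≤ wt ξ e'`. [folklore] -/
theorem chain_le_iff {ξ : Fin 2 → ℝ} (h0 : ξ 0 < 0) (h1 : ξ 1 < 0) {e e' : Expo}
    (hch : (e 0 ≤ e' 0 ∧ e 1 ≤ e' 1) ∨ (e' 0 ≤ e 0 ∧ e' 1 ≤ e 1)) :
    (e' 0 ≤ e 0 ∧ e' 1 ≤ e 1) ↔ wt ξ e ≤ wt ξ e' := by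
  have key : ∀ x y : Expo, (x 0 ≤ y 0 ∧ x 1 ≤ y 1) → wt ξ y ≤ wt ξ x := by
    intro x y ⟨hx0, hx1⟩
    simp only [wt]
    have c0 : ((x 0 : ℕ) : ℝ) ≤ y 0 := by exact_mod_cast hx0
    have c1 : ((x 1 : ℕ) : ℝ) ≤ y 1 := by exact_mod_cast hx1
    nlinarith
  constructor
  · exact key e' e
  · intro hw
    rcases hch with h | h
    · -- `e ≤ e'` componentwise: then the weights force equality
      have hw' := key e e' h
      by_contra hne
      have hstrict : e 0 < e' 0 ∨ e 1 < e' 1 := by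
        rcases not_and_or.1 hne with h' | h'
        · exact Or.inl (by omega)
        · exact Or.inr (by omega)
      have : wt ξ e' < wt ξ e := by
        simp only [wt]
        rcases hstrict with hs | hs
        · have c0 : ((e 0 : ℕ) : ℝ) + 1 ≤ e' 0 := by exact_mod_cast hs
          have c1 : ((e 1 : ℕ) : ℝ) ≤ e' 1 := by exact_mod_cast h.2
          nlinarith
        · have c0 : ((e 0 : ℕ) : ℝ) ≤ e' 0 := by exact_mod_cast h.1
          have c1 : ((e 1 : ℕ) : ℝ) + 1 ≤ e' 1 := by exact_mod_cast hs
          nlinarith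
      linarith
    · exact h

/-! ### Constant terms and validity -/

/-- A polynomial supported in `pts` has no constant term. [folklore] -/
theorem coeff_zero_of_subset_pts (K : ℕ) {p : MvPolynomial (Fin 2) ℂ} (hp : p.support ⊆ pts K) :
    coeff 0 p = 0 := by
  by_contra h
  have hmem : (0 : Expo) ∈ p.support := mem_support_iff.2 h
  have := (pts_bounds K (hp hmem)).1
  simp at this

/-- The tails `u` have no constant term. [folklore] -/
theorem coeff_zero_uu (K : ℕ) (j : Fin 2) : coeff 0 (uu K j) = 0 :=
  coeff_zero_of_subset_pts K (support_uu_subset K j)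

/-- The tails `v` have no constant term. [folklore] -/
theorem coeff_zero_vv (K : ℕ) (j : Fin 2) : coeff 0 (vv K j) = 0 :=
  coeff_zero_of_subset_pts K (support_vv_subset K j)

/-- `ξ_k` is negative on every possible tail exponent. [folklore] -/
theorem wt_xi_neg_of_mem_pts (K k : ℕ) {e : Expo} (he : e ∈ pts K) : wt (xi k) e < 0 := by
  rw [wt_xi]
  have h0 : (1 : ℝ) ≤ e 0 := by exact_mod_cast (pts_bounds K he).1
  have h1 : (0 : ℝ) ≤ e 1 := by positivity
  have hk : (0 : ℝ) ≤ k := by positivity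
  nlinarith

/-- `ξ_k` is a valid weight of the instance. [folklore] -/
theorem validWeight_xi (K k : ℕ) : ValidWeight (uu K) (vv K) (xi k) :=
  ⟨fun j _ he => wt_xi_neg_of_mem_pts K k (support_uu_subset K j he),
   fun j _ he => wt_xi_neg_of_mem_pts K k (support_vv_subset K j he)⟩

/-! ### The corners are strict tops -/

/-- The corner `(k, K-k)` survives. [folklore] -/
theorem corner_mem_high (K k : ℕ) (hk : k ≤ K) : (k, K - k) ∈ high K := by
  rw [mem_high]
  exact ⟨hk, Nat.sub_le K k, by simp only; omega⟩

/-- The corner `q_k = p_{k,K-k}` is the strict `ξ_k`-top of `supp W`. [folklore] -/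
theorem isStrictTop_corner (K k : ℕ) (hk : k ≤ K) :
    IsStrictTop (xi k) ↑(Wpoly K).support (ppt K (k, K - k)) := by
  refine ⟨?_, ?_⟩
  · rw [Finset.mem_coe, support_W]
    exact Finset.mem_image.2 ⟨(k, K - k), corner_mem_high K k hk, rfl⟩
  · intro μ hμ hne
    rw [Finset.mem_coe, support_W, Finset.mem_image] at hμ
    obtain ⟨ij, hij, rfl⟩ := hμ
    have hne' : (ij.1, ij.2) ≠ (k, K - k) := fun h => hne (by rw [← h])
    rw [mem_high] at hij
    have hlt := cost_corner_lt K k ij.1 ij.2 hk hij.1 hij.2.2 hne'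
    rw [wt_xi_ppt, wt_xi_ppt]
    simp only
    exact_mod_cast neg_lt_neg (by exact_mod_cast hlt : ((cost K k k (K - k) : ℕ) : ℝ) < cost K k ij.1 ij.2)

/-- The corner `q_k` is the strict `ξ_k`-top of the log-support `supp D` (by `stub_logLinearisation`, p584485), i.e. it is log-visible. [folklore] -/
theorem isStrictTop_corner_log (K k : ℕ) (hk : k ≤ K) :
    IsStrictTop (xi k) (logSupport (uu K) (vv K)) (ppt K (k, K - k)) := by
  have h := isStrictTop_corner K k hk
  rw [← tailDiff_eq] at h
  exact (stub_logLinearisation 2 (uu K) (vv K) (coeff_zero_uu K) (coeff_zero_vv K) (xi k)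
    (validWeight_xi K k) _).1 h

/-! ### The tail support -/

/-- The tail support (inline form used by `PlanarCellBound` / `PlanarSlotBound`). [folklore] -/
def tsupp (K : ℕ) : Finset Expo :=
  (Finset.univ.biUnion fun j => (uu K j).support) ∪ Finset.univ.biUnion fun j => (vv K j).support

/-- The tail support lies in `pts`. [folklore] -/
theorem tsupp_subset_pts (K : ℕ) : tsupp K ⊆ pts K := by
  intro e he
  simp only [tsupp, Finset.mem_union, Finset.mem_biUnion, Finset.mem_univ, true_and] at he
  rcases he with ⟨j, hj⟩ | ⟨j, hj⟩
  · exact support_uu_subset K j hj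
  · exact support_vv_subset K j hj

/-- `f_k` is a tail exponent (of `u₀`). [folklore] -/
theorem fpt_mem_tsupp (K k : ℕ) (hk : k ≤ K) : fpt K k ∈ tsupp K := by
  simp only [tsupp, Finset.mem_union, Finset.mem_biUnion, Finset.mem_univ, true_and]
  left
  refine ⟨0, ?_⟩
  simp only [uu, Matrix.cons_val_zero, support_u0]
  exact Finset.mem_image.2 ⟨k, mem_idx.2 hk, rfl⟩

/-- `g_j` is a tail exponent (of `u₁`). [folklore] -/
theorem gpt_mem_tsupp (K j : ℕ) (hj : j ≤ K) : gpt K j ∈ tsupp K := by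
  simp only [tsupp, Finset.mem_union, Finset.mem_biUnion, Finset.mem_univ, true_and]
  left
  refine ⟨1, ?_⟩
  simp only [uu, Matrix.cons_val_one, Matrix.cons_val_zero, support_u1]
  exact Finset.mem_image.2 ⟨j, mem_idx.2 hj, rfl⟩

/-- Row and column exponents differ. [folklore] -/
theorem fpt_ne_gpt (K k j : ℕ) (hk : k ≤ K) : fpt K k ≠ gpt K j := by
  intro h
  have := congrArg (fun e : Expo => e 0) h
  simp only [fpt_zero, gpt_zero] at this
  have := a_lt_b K k j hk
  omega

/-! ### The refutation -/

/-- **`PlanarSlotBound` (SUB₂ of line `planar_cell`) is false.**  The statement below is the line's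
`PlanarCell.PlanarSlotBound` (`Cruxes/TwoProducts/Lines/planar_cell.lean` @766c1b2fd55d, l.484) UNFOLDED verbatim
(`lam E (rep d) = ∑ i, rep d i • E i`, `tailSupport u v` = the union of the tail supports).  Witness family: `m = 2`,
`c = 1`, and for the purported `c'` the staircase instance with `K = 4^{c'}`: its `K + 1` corners are log-visible
points of ONE weight-order cell with cross representatives of slot exponent `1`, so `#D = K + 1 > (2·2)^{c'}`. -/
theorem _root_.Summit.ValiantsHypothesis.ValiantsHypothesis.Theorems.TwoProducts.Negative.not_planarSlotBound :
    ¬ (∀ c : ℕ, ∃ c' : ℕ, ∀ (m : ℕ) (u v : Fin m → MvPolynomial (Fin 2) ℂ),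
      (∀ j, coeff 0 (u j) = 0) → (∀ j, coeff 0 (v j) = 0) →
      ∀ (s : ℕ) (E : Fin s → Expo), Function.Injective E →
        Set.range E = ↑((Finset.univ.biUnion fun j => (u j).support) ∪
          Finset.univ.biUnion fun j => (v j).support) →
      ∀ (R : Fin s → Fin s → Prop) (e : ℕ), 1 ≤ e → ∀ (D : Finset (Fin s)) (rep : Fin s → (Fin s → ℕ)),
        (∀ d ∈ D, rep d d = e ∧ ∏ i, (rep d i + 1) ≤ (2 * m) ^ c ∧
          ∃ ξ : Fin 2 → ℝ, ValidWeight u v ξ ∧ IsStrictTop ξ (logSupport u v) (∑ i, rep d i • E i) ∧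
            ∀ j j' : Fin s, R j j' ↔ wt ξ (E j) ≤ wt ξ (E j')) →
        Set.InjOn (fun d => ∑ i, rep d i • E i) ↑D → D.card ≤ (2 * m) ^ c') := by
  classical
  intro hPSB
  obtain ⟨c', hc'⟩ := hPSB 1
  -- the instance: `K = 4^{c'}`
  obtain ⟨K, hK⟩ : ∃ K : ℕ, K = 4 ^ c' := ⟨_, rfl⟩
  -- enumeration of the tail support
  let T : Finset Expo := tsupp K
  let σ := T.equivFin
  let E : Fin T.card → Expo := fun i => ((σ.symm i : T) : Expo)
  have hEσ : ∀ (x : Expo) (hx : x ∈ T), E (σ ⟨x, hx⟩) = x := fun x hx => by simp [E]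
  have hEinj : Function.Injective E := fun i i' h => σ.symm.injective (Subtype.ext h)
  have hErange : Set.range E = ↑T := by
    ext x
    constructor
    · rintro ⟨i, rfl⟩
      exact (σ.symm i).2
    · intro hx
      exact ⟨σ ⟨x, hx⟩, hEσ x hx⟩
  have hEmem : ∀ i, E i ∈ pts K := fun i => tsupp_subset_pts K (σ.symm i).2
  -- indices of the row exponents `f_k` and of the partner columns `g_{K-k}`
  let ι : ℕ → Fin T.card := fun k =>
    if h : k ≤ K then σ ⟨fpt K k, fpt_mem_tsupp K k h⟩ else σ ⟨fpt K 0, fpt_mem_tsupp K 0 (Nat.zero_le _)⟩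
  let ι' : ℕ → Fin T.card := fun k => σ ⟨gpt K (K - k), gpt_mem_tsupp K (K - k) (Nat.sub_le _ _)⟩
  have hEι : ∀ k, k ≤ K → E (ι k) = fpt K k := fun k hk => by
    simp only [ι, dif_pos hk]
    exact hEσ _ _
  have hEι' : ∀ k, E (ι' k) = gpt K (K - k) := fun k => hEσ _ _
  have hιne : ∀ k, k ≤ K → ι k ≠ ι' k := by
    intro k hk h
    have := congrArg E h
    rw [hEι k hk, hEι' k] at this
    exact fpt_ne_gpt K k (K - k) hk this
  -- recover `k` from the index of `f_k`
  let kOf : Fin T.card → ℕ := fun d => ∑ k ∈ idx K, if E d = fpt K k then k else 0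
  have hkOf : ∀ k, k ≤ K → kOf (ι k) = k := by
    intro k hk
    simp only [kOf, hEι k hk]
    rw [Finset.sum_eq_single_of_mem k (mem_idx.2 hk)]
    · simp
    · intro k' _ hk'
      rw [if_neg]
      exact fun h => hk' ((fpt_injective K h).symm)
  -- the set `D`, the representatives, the cell relation
  let D : Finset (Fin T.card) := (idx K).image ι
  let rep : Fin T.card → (Fin T.card → ℕ) := fun d => Pi.single d 1 + Pi.single (ι' (kOf d)) 1
  let R : Fin T.card → Fin T.card → Prop := fun j j' => E j' 0 ≤ E j 0 ∧ E j' 1 ≤ E j 1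
  have hrep : ∀ k, k ≤ K → rep (ι k) = Pi.single (ι k) 1 + Pi.single (ι' k) 1 := fun k hk => by
    simp only [rep, hkOf k hk]
  have hlam : ∀ k, k ≤ K → ∑ i, rep (ι k) i • E i = ppt K (k, K - k) := by
    intro k hk
    rw [hrep k hk, sum_two_bumps_smul, hEι k hk, hEι' k]
    rfl
  have hxi0 : ∀ k : ℕ, xi k 0 < 0 := fun k => by rw [xi_zero]; norm_num
  have hxi1 : ∀ k : ℕ, xi k 1 < 0 := fun k => by
    rw [xi_one]
    have : (0 : ℝ) ≤ k := by positivity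
    linarith
  have hD : ∀ d ∈ D, rep d d = 1 ∧ ∏ i, (rep d i + 1) ≤ (2 * 2) ^ 1 ∧
      ∃ ξ : Fin 2 → ℝ, ValidWeight (uu K) (vv K) ξ ∧
        IsStrictTop ξ (logSupport (uu K) (vv K)) (∑ i, rep d i • E i) ∧
        ∀ j j' : Fin T.card, R j j' ↔ wt ξ (E j) ≤ wt ξ (E j') := by
    intro d hd
    obtain ⟨k, hk, rfl⟩ := Finset.mem_image.1 hd
    rw [mem_idx] at hk
    refine ⟨?_, ?_, xi k, validWeight_xi K k, ?_, fun j j' => ?_⟩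
    · rw [hrep k hk, Pi.add_apply, Pi.single_eq_same, Pi.single_eq_of_ne (hιne k hk), add_zero]
    · rw [hrep k hk, prod_two_bumps _ _ (hιne k hk)]
      norm_num
    · rw [hlam k hk]
      exact isStrictTop_corner_log K k hk
    · exact chain_le_iff (hxi0 k) (hxi1 k) (pts_chain K (hEmem j) (hEmem j'))
  have hinj : Set.InjOn (fun d => ∑ i, rep d i • E i) ↑D := by
    intro d hd d' hd' heq
    obtain ⟨k, hk, rfl⟩ := Finset.mem_image.1 hd
    obtain ⟨k', hk', rfl⟩ := Finset.mem_image.1 hd'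
    rw [mem_idx] at hk hk'
    dsimp only at heq
    rw [hlam k hk, hlam k' hk'] at heq
    have := ppt_injective K heq
    simp only [Prod.mk.injEq] at this
    rw [this.1]
  have hmain := hc' 2 (uu K) (vv K) (coeff_zero_uu K) (coeff_zero_vv K) T.card E hEinj hErange
    R 1 le_rfl D rep hD hinj
  have hcard : D.card = K + 1 := by
    rw [Finset.card_image_of_injOn]
    · simp [idx]
    · intro k hk k' hk' h
      rw [Finset.mem_coe, mem_idx] at hk hk'
      have := congrArg E h
      rw [hEι k hk, hEι k' hk'] at this
      exact fpt_injective K this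
  rw [hcard] at hmain
  have h4 : (2 * 2) ^ c' = K := by rw [hK]
  omega


end PlanarSlotBoundFalse

end Summit.ValiantsHypothesis.ValiantsHypothesis.Theorems.TwoProducts.Negative

end
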